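import Summits.Ventures.HodgeRepro.FaceCensusEngine

/-!
# Reduced-product patterns of the census faces — definitions on the sealed engine (seat p1)

For a face `f = (Φ; π, π′)` of the model `(G, c)` of `FaceCensusEngine.lean`, the corner product `B = ∏_L A_L` over the
four corners decomposes up to isogeny into simple factors: `A_L ~ B_L^{|Stab L|}` with `B_L` simple of dimension
`n / (2 |Stab L|)`, where `Stab L = {g : L·g = L}` is the right stabiliser of the type `L` (Milne, *Lefschetz motives and
the Tate conjecture*, Compositio Math. 117 (1999), Prop. 2.1: simple CM abelian varieties ↔ pairs (CM field, primitive
type); a type with stabiliser `H` is lifted from `F^H`), and `B_L ~ B_{L′}` exactly when `L′ ∈ L·G` (a right translate: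
the same pair up to Galois).  The REDUCED PRODUCT `B_red` of the face is the product of the distinct simple factors of its
corners; its PATTERN is the sorted list of their dimensions.  This file defines, as closed `Bool`/`ℕ` computations on the
sealed Cayley tables: the translate list `L·G` of a type, the stabiliser order, the twist classes among the four corners
with their multiplicities, the reduced-product / class-size / stabiliser-order patterns of a face, and the histogram of such
a pattern over all faces of a row.  The census rows (`FaceFactorRows*.lean`) evaluate them on the eleven sealed rows.
Definitions only; nothing is proved or asserted here.
-/

set_option autoImplicit false

namespace Summit.Ventures.HodgeRepro.FaceCensus

/-- The twist classes of a list of corner data `(L, L·G)`: one entry `(L, L·G, m)` per class, `m` = number of corners in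
the class (`L` = the last corner of the class in list order; any member gives the same `L·G` and `|Stab|`). -/
def classesOf : List (ℕ × List ℕ) → List (ℕ × List ℕ × ℕ)
  | [] => []
  | d :: ds =>
    let rest := classesOf ds
    if rest.any fun c => c.2.1.contains d.1 then
      rest.map fun c => if c.2.1.contains d.1 then (c.1, c.2.1, c.2.2 + 1) else c
    else (d.1, d.2, 1) :: rest

/-- `|Stab L|`, read off the translate list `L·G` (one entry per group element): the number of entries equal to `L`. -/
def stabOrderOf (d : ℕ × List ℕ) : ℕ := (d.2.filter fun T' => T' == d.1).length

namespace CMGaloisType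

variable {n : ℕ} (Γ : CMGaloisType n)

/-- The right translates `T·g_j` of a type, one entry per `j : Fin n` (so `T` itself occurs `|Stab T|` times). -/
def translates (T : ℕ) : List ℕ := (List.finRange n).map fun j => Γ.twist j T

/-- The translate table: every CM type with its list of right translates (computed once per declaration; the kernel
re-uses the evaluated closed term at every lookup). -/
def typeTable : List (ℕ × List ℕ) := Γ.cmTypes.map fun T => (T, Γ.translates T)

/-- The translate list of a type, looked up in `typeTable` (for a CM type this is `translates T`; the fallback `[T]` is never
reached for the corners of a face, which are CM types). -/
def translatesOf (T : ℕ) : List ℕ := ((Γ.typeTable.find? fun d => d.1 == T).map fun d => d.2).getD [T]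

/-- The four corners of `f` with their translate lists. -/
def cornerData (f : ℕ × ℕ × ℕ) : List (ℕ × List ℕ) := (Γ.corners f).map fun T => (T, Γ.translatesOf T)

/-- The stabiliser orders `|Stab L|` of the four corners, sorted. -/
def stabPattern (f : ℕ × ℕ × ℕ) : List ℕ := sortNat ((Γ.cornerData f).map stabOrderOf)

/-- The sizes of the twist classes `L·G ∩ corners` among the four corners, sorted (`[1,1,1,1]` = four distinct simple
factors, `[2,2]` = two pairs of twists, …). -/
def classPattern (f : ℕ × ℕ × ℕ) : List ℕ := sortNat ((classesOf (Γ.cornerData f)).map fun c => c.2.2)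

/-- The reduced-product pattern of the face: the dimensions `n / (2|Stab L|)` of the distinct simple factors of its
corners, sorted (`[4, 4]` = `A₁ × A₂`, two non-isogenous simple fourfolds; `[1, 1, 4]` = `A × E × E′`; …). -/
def reducedPattern (f : ℕ × ℕ × ℕ) : List ℕ :=
  sortNat ((classesOf (Γ.cornerData f)).map fun c => n / (2 * stabOrderOf (c.1, c.2.1)))

/-- The three patterns of a face at once, from one corner-data computation: `reducedPattern ++ 0 :: classPattern ++ 0 :: stabPattern`
(`0` never occurs inside a pattern, so the three blocks are recoverable). -/
def patterns (f : ℕ × ℕ × ℕ) : List ℕ :=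
  let D := Γ.cornerData f
  let cs := classesOf D
  sortNat (cs.map fun c => n / (2 * stabOrderOf (c.1, c.2.1))) ++ 0 :: sortNat (cs.map fun c => c.2.2) ++ 0 :: sortNat (D.map stabOrderOf)

/-- Add one occurrence of `p` to a histogram (pairs `(value, count)`; a new value is appended). -/
def bump (acc : List (List ℕ × ℕ)) (p : List ℕ) : List (List ℕ × ℕ) :=
  if acc.any fun q => q.1 == p then acc.map (fun q => if q.1 == p then (q.1, q.2 + 1) else q) else acc ++ [(p, 1)]

/-- Add a whole histogram to another (each `(p, k)` of `h` adds `k` to the count of `p` in `acc`, appending new values). -/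
def mergeHist (acc h : List (List ℕ × ℕ)) : List (List ℕ × ℕ) :=
  h.foldl (fun a q => if a.any fun r => r.1 == q.1 then a.map (fun r => if r.1 == q.1 then (r.1, r.2 + q.2) else r) else a ++ [q]) acc

/-- The faces with base type `T` (the slice of `faces` at `T`: `faces = cmTypes.flatMap facesOf`). -/
def facesOf (T : ℕ) : List (ℕ × ℕ × ℕ) := Γ.places.flatMap fun p => (Γ.places.filter fun q => q != p).map fun q => (T, p, q)

/-- Histogram of a face invariant over the slice of faces with base type `T`. -/
def sliceHist (g : ℕ × ℕ × ℕ → List ℕ) (T : ℕ) : List (List ℕ × ℕ) := (Γ.facesOf T).foldl (fun acc f => bump acc (g f)) []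

/-- Histogram of a face invariant over ALL faces of the row: the pairs `(value, number of faces)`, in order of first
occurrence along `faces`; computed slice by slice (one fold per base type, then a merge of the `2^{n/2}` partial
histograms — the same result as one fold over `faces`, with shallow nesting for the kernel). -/
def histogram (g : ℕ × ℕ × ℕ → List ℕ) : List (List ℕ × ℕ) := (Γ.cmTypes.map (Γ.sliceHist g)).foldl mergeHist []

end CMGaloisType

end Summit.Ventures.HodgeRepro.FaceCensus
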